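import Summits.Ventures.LatticeQCDFlow.Exactness.IMHCoupledUnbiasedEstimator
import Summits.Ventures.LatticeQCDFlow.Exactness.IMHCommonRandomNumbersContraction
import HarnessLib

/-!
# The lag-`L` coupled flow-MCMC estimator is exactly unbiased: with the first run `L` updates ahead, `H_k^{(L)} = f(Y_k) + Σ_{j≥0}(f(X′_{k+jL}) − f(Y_{k+jL}))`
# has `E H_k^{(L)} = π f` from every start, with corrections only every `L` steps and expected correction work `≤ (1 − A)^k(c − a)/(1 − (1 − A)^L)`

HONEST FRAMING: exact (Metropolis-corrected) sampling algorithms for lattice gauge theory;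
figures of merit are autocorrelation/cost numbers at stated couplings and volumes; no
continuum-physics claim.

Venture `LatticeQCDFlow` (cell pub-lqcd), topic `Exactness`; FANOUT row 30 (lean-1, GEN-39).  NEW WORK of the cell, general state space; the
LAG-`L` generalisation of GEN-36's `Exactness/IMHCoupledUnbiasedEstimator` (lag one: first run ONE update ahead, `μ̂₀∘fst⁻¹ = (μ̂₀∘snd⁻¹)K`).
Here the common-random-numbers pair chain of `K = indepMH q w` is run from an initial coupling whose first coordinate is `L` UPDATES AHEAD of its
second (`μ̂₀∘fst⁻¹ = (μ̂₀∘snd⁻¹)K^L`, any `L ≥ 1`), so `X′_n` has the law of `Y_{n+L}`; the corrections are taken every `L` steps,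
`D_j^{(L)} = f(X′_{k+jL}) − f(Y_{k+jL})` (the printed lag-`L` unbiased estimator — named only, nothing cited; `W = w(x₀)`, `r = 1 − 1/W`, `a ≤ f ≤ c`):

* §1 **`crnLagL_integral_fst_eq`** — `E f(X′_n) = (μ₂K^{n+L}) f`; **`crnLagL_integral_diff_eq`** — `E D_j^{(L)} = (μ₂K^{k+jL+L}) f − (μ₂K^{k+jL}) f`:
  the corrections telescope in expectation along the arithmetic progression `k + jL`; **`crnLagL_integral_abs_diff_le`** —
  `E|D_j^{(L)}| ≤ r^{k+jL}(c − a)`; **`crnLagL_summable_integral_abs_diff`**; **`crnLagL_tsum_integral_abs_diff_le`** — total expected correction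
  work `Σ_j E|D_j^{(L)}| ≤ r^k(c − a)/(1 − r^L)` (lag one: `r^k(c − a)/(1 − r) = r^k(c − a)W`).
* §2 **`crnLagL_hasSum_integral_diff`** — `Σ_{j≥0} E D_j^{(L)} = π f − E f(Y_k)` EXACTLY; **`crnLagL_integral_tsum_diff_eq`** — the expectation of
  the summed corrections is the sum (dominated convergence); **`crnLagL_unbiased`** — `E f(Y_k) + E[Σ_{j≥0} D_j^{(L)}] = π f`: THE LAG-`L` COUPLED
  ESTIMATOR IS EXACTLY UNBIASED FROM EVERY START, FOR EVERY `L ≥ 1` AND EVERY `k`.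
Reading (gauge files): two exact gauge samplers on one stream of random numbers, one started `L` updates ahead, give an estimator of every bounded
observable with no burn-in bias whose corrections are read only every `L` updates; the expected total correction is `≤ (1 − A)^k(c − a)/(1 − (1 − A)^L)`.
NOT CLAIMED: the variance of `H_k^{(L)}` (the lag-one analysis of GEN-37/38 adapts; not typed); the time-averaged lag-`L` estimator; anything for
unbounded `f`; any value of `A`.  No `sorry`, no new definitions, nothing cited as a fact.
-/

noncomputable section

namespace Summit.Ventures.LatticeQCDFlow.Exactness

open MeasureTheory ProbabilityTheory Function Finset Filter
open scoped ENNReal unitInterval Topology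
open Summit.Ventures.LatticeQCDFlow.Scoring

variable {Ω : Type*} [MeasurableSpace Ω] {q : Measure Ω} [IsProbabilityMeasure q] {w : Ω → ℝ}

/-! ## §1 The lag-`L` marginal identities and the geometric envelope -/

/-- **`E f(X′_n) = (μ₂K^{n+L}) f`** under the lag-`L` condition `μ̂₀∘fst⁻¹ = (μ̂₀∘snd⁻¹)K^L` (`|f| ≤ C` measurable). [ours] -/
theorem crnLagL_integral_fst_eq [Fact (Measurable w)] (hw0 : ∀ y, 0 < w y) (Khat : Kernel (Ω × Ω) (Ω × Ω))
    [IsMarkovKernel Khat]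
    (hK : ∀ z : Ω × Ω, Khat z = (q.prod (volume : Measure unitInterval)).map (fun p : Ω × unitInterval =>
      ((if (p.2 : ℝ) * w z.1 ≤ w p.1 then p.1 else z.1), (if (p.2 : ℝ) * w z.2 ≤ w p.1 then p.1 else z.2))))
    (μ₀ : Measure (Ω × Ω)) [IsProbabilityMeasure μ₀] {L : ℕ}
    (hlag : μ₀.map Prod.fst = (fun m : Measure Ω => m.bind (indepMH q w))^[L] (μ₀.map Prod.snd)) {f : Ω → ℝ} (hf : Measurable f)
    {C : ℝ} (hC : ∀ x, |f x| ≤ C) (n : ℕ) :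
    ∫ z, f ((z n).1) ∂(Kernel.trajMeasure (X := fun _ : ℕ => Ω × Ω) μ₀
        (fun n : ℕ => Khat.comap (fun h : (i : ↥(Finset.Iic n)) → Ω × Ω => h ⟨n, Finset.mem_Iic.2 le_rfl⟩)
          (measurable_pi_apply _))) =
      ∫ y, f y ∂((fun m : Measure Ω => m.bind (indepMH q w))^[n + L] (μ₀.map Prod.snd)) := by
  rw [chain_expect_eq_integral_iterate_bind Khat μ₀ (f := fun p : Ω × Ω => f p.1) (hf.comp measurable_fst)
      (fun p => hC p.1) n, Function.iterate_add_apply, ← hlag, ← iterate_bind_crnPair_map_fst Fact.out hw0 Khat hK n μ₀,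
    integral_map measurable_fst.aemeasurable hf.aestronglyMeasurable]

/-- **THE LAG-`L` CORRECTIONS TELESCOPE IN EXPECTATION**: `E[f(X′_{k+jL}) − f(Y_{k+jL})] = (μ₂K^{k+jL+L}) f − (μ₂K^{k+jL}) f`. [ours] -/
theorem crnLagL_integral_diff_eq [Fact (Measurable w)] (hw0 : ∀ y, 0 < w y) (Khat : Kernel (Ω × Ω) (Ω × Ω))
    [IsMarkovKernel Khat]
    (hK : ∀ z : Ω × Ω, Khat z = (q.prod (volume : Measure unitInterval)).map (fun p : Ω × unitInterval =>
      ((if (p.2 : ℝ) * w z.1 ≤ w p.1 then p.1 else z.1), (if (p.2 : ℝ) * w z.2 ≤ w p.1 then p.1 else z.2))))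
    (μ₀ : Measure (Ω × Ω)) [IsProbabilityMeasure μ₀] {L : ℕ}
    (hlag : μ₀.map Prod.fst = (fun m : Measure Ω => m.bind (indepMH q w))^[L] (μ₀.map Prod.snd)) {f : Ω → ℝ} (hf : Measurable f)
    {C : ℝ} (hC : ∀ x, |f x| ≤ C) (k j : ℕ) :
    ∫ z, (f ((z (k + j * L)).1) - f ((z (k + j * L)).2)) ∂(Kernel.trajMeasure (X := fun _ : ℕ => Ω × Ω) μ₀
        (fun n : ℕ => Khat.comap (fun h : (i : ↥(Finset.Iic n)) → Ω × Ω => h ⟨n, Finset.mem_Iic.2 le_rfl⟩)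
          (measurable_pi_apply _))) =
      ∫ y, f y ∂((fun m : Measure Ω => m.bind (indepMH q w))^[k + j * L + L] (μ₀.map Prod.snd)) -
        ∫ y, f y ∂((fun m : Measure Ω => m.bind (indepMH q w))^[k + j * L] (μ₀.map Prod.snd)) := by
  set P := Kernel.trajMeasure (X := fun _ : ℕ => Ω × Ω) μ₀
        (fun n : ℕ => Khat.comap (fun h : (i : ↥(Finset.Iic n)) → Ω × Ω => h ⟨n, Finset.mem_Iic.2 le_rfl⟩)
          (measurable_pi_apply _)) with hP
  have h1 : Integrable (fun z : ℕ → Ω × Ω => f ((z (k + j * L)).1)) P :=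
    integrable_of_bounded P (hf.comp (measurable_fst.comp (measurable_pi_apply _))) (fun z => hC _)
  have h2 : Integrable (fun z : ℕ → Ω × Ω => f ((z (k + j * L)).2)) P :=
    integrable_of_bounded P (hf.comp (measurable_snd.comp (measurable_pi_apply _))) (fun z => hC _)
  rw [integral_sub h1 h2, crnLagL_integral_fst_eq hw0 Khat hK μ₀ hlag hf hC (k + j * L), crnLag_integral_snd_eq hw0 Khat hK μ₀ hf hC (k + j * L)]

/-- **THE GEOMETRIC ENVELOPE**: `E|f(X′_{k+jL}) − f(Y_{k+jL})| ≤ r^{k+jL}(c − a) ≤ r^k (r^L)^j (c − a)`, from every initial coupling (no lag condition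
needed). [ours] -/
theorem crnLagL_integral_abs_diff_le [Fact (Measurable w)] (hw0 : ∀ y, 0 < w y) {x₀ : Ω} (hmax : ∀ y, w y ≤ w x₀)
    [IsProbabilityMeasure (q.withDensity fun y => ENNReal.ofReal (w y))]
    (Khat : Kernel (Ω × Ω) (Ω × Ω)) [IsMarkovKernel Khat]
    (hK : ∀ z : Ω × Ω, Khat z = (q.prod (volume : Measure unitInterval)).map (fun p : Ω × unitInterval =>
      ((if (p.2 : ℝ) * w z.1 ≤ w p.1 then p.1 else z.1), (if (p.2 : ℝ) * w z.2 ≤ w p.1 then p.1 else z.2))))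
    (μ₀ : Measure (Ω × Ω)) [IsProbabilityMeasure μ₀] {f : Ω → ℝ} (hf : Measurable f) {a c : ℝ}
    (ha : ∀ x, a ≤ f x) (hc : ∀ x, f x ≤ c) (k L j : ℕ) :
    ∫ z, |f ((z (k + j * L)).1) - f ((z (k + j * L)).2)| ∂(Kernel.trajMeasure (X := fun _ : ℕ => Ω × Ω) μ₀
        (fun n : ℕ => Khat.comap (fun h : (i : ↥(Finset.Iic n)) → Ω × Ω => h ⟨n, Finset.mem_Iic.2 le_rfl⟩)
          (measurable_pi_apply _))) ≤ (1 - (w x₀)⁻¹) ^ k * ((1 - (w x₀)⁻¹) ^ L) ^ j * (c - a) := by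
  have h := crnLag_integral_abs_diff_le hw0 hmax Khat hK μ₀ hf ha hc (k + j * L)
  refine h.trans_eq ?_
  rw [pow_add, pow_mul']

/-- **THE EXPECTED LAG-`L` CORRECTIONS ARE ABSOLUTELY SUMMABLE** (`L ≥ 1`). [ours] -/
theorem crnLagL_summable_integral_abs_diff [Fact (Measurable w)] (hw0 : ∀ y, 0 < w y) {x₀ : Ω}
    (hmax : ∀ y, w y ≤ w x₀) [IsProbabilityMeasure (q.withDensity fun y => ENNReal.ofReal (w y))]
    (Khat : Kernel (Ω × Ω) (Ω × Ω)) [IsMarkovKernel Khat]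
    (hK : ∀ z : Ω × Ω, Khat z = (q.prod (volume : Measure unitInterval)).map (fun p : Ω × unitInterval =>
      ((if (p.2 : ℝ) * w z.1 ≤ w p.1 then p.1 else z.1), (if (p.2 : ℝ) * w z.2 ≤ w p.1 then p.1 else z.2))))
    (μ₀ : Measure (Ω × Ω)) [IsProbabilityMeasure μ₀] {f : Ω → ℝ} (hf : Measurable f) {a c : ℝ}
    (ha : ∀ x, a ≤ f x) (hc : ∀ x, f x ≤ c) (k : ℕ) {L : ℕ} (hL : 1 ≤ L) :
    Summable (fun j : ℕ => ∫ z, |f ((z (k + j * L)).1) - f ((z (k + j * L)).2)|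
      ∂(Kernel.trajMeasure (X := fun _ : ℕ => Ω × Ω) μ₀
        (fun n : ℕ => Khat.comap (fun h : (i : ↥(Finset.Iic n)) → Ω × Ω => h ⟨n, Finset.mem_Iic.2 le_rfl⟩)
          (measurable_pi_apply _)))) := by
  have hW : 1 ≤ w x₀ := one_le_of_mode (q := q) hmax
  have hr0 : 0 ≤ 1 - (w x₀)⁻¹ := sub_nonneg.2 (inv_le_one_of_one_le₀ hW)
  have hr1 : 1 - (w x₀)⁻¹ < 1 := sub_lt_self _ (inv_pos.mpr (hw0 x₀))
  have hrL0 : 0 ≤ (1 - (w x₀)⁻¹) ^ L := pow_nonneg hr0 L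
  have hrL1 : (1 - (w x₀)⁻¹) ^ L < 1 := pow_lt_one₀ hr0 hr1 (by omega)
  refine Summable.of_nonneg_of_le (fun j => integral_nonneg fun z => abs_nonneg _)
    (fun j => crnLagL_integral_abs_diff_le hw0 hmax Khat hK μ₀ hf ha hc k L j) ?_
  have : Summable (fun j : ℕ => (1 - (w x₀)⁻¹) ^ k * (c - a) * ((1 - (w x₀)⁻¹) ^ L) ^ j) :=
    (summable_geometric_of_lt_one hrL0 hrL1).mul_left _
  refine this.congr fun j => ?_
  ring

/-- **TOTAL EXPECTED LAG-`L` CORRECTION WORK**: `Σ_{j≥0} E|D_j^{(L)}| ≤ r^k(c − a)/(1 − r^L)` (`L ≥ 1`). [ours] -/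
theorem crnLagL_tsum_integral_abs_diff_le [Fact (Measurable w)] (hw0 : ∀ y, 0 < w y) {x₀ : Ω}
    (hmax : ∀ y, w y ≤ w x₀) [IsProbabilityMeasure (q.withDensity fun y => ENNReal.ofReal (w y))]
    (Khat : Kernel (Ω × Ω) (Ω × Ω)) [IsMarkovKernel Khat]
    (hK : ∀ z : Ω × Ω, Khat z = (q.prod (volume : Measure unitInterval)).map (fun p : Ω × unitInterval =>
      ((if (p.2 : ℝ) * w z.1 ≤ w p.1 then p.1 else z.1), (if (p.2 : ℝ) * w z.2 ≤ w p.1 then p.1 else z.2))))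
    (μ₀ : Measure (Ω × Ω)) [IsProbabilityMeasure μ₀] {f : Ω → ℝ} (hf : Measurable f) {a c : ℝ}
    (ha : ∀ x, a ≤ f x) (hc : ∀ x, f x ≤ c) (k : ℕ) {L : ℕ} (hL : 1 ≤ L) :
    ∑' j : ℕ, ∫ z, |f ((z (k + j * L)).1) - f ((z (k + j * L)).2)|
      ∂(Kernel.trajMeasure (X := fun _ : ℕ => Ω × Ω) μ₀
        (fun n : ℕ => Khat.comap (fun h : (i : ↥(Finset.Iic n)) → Ω × Ω => h ⟨n, Finset.mem_Iic.2 le_rfl⟩)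
          (measurable_pi_apply _))) ≤ (1 - (w x₀)⁻¹) ^ k * (c - a) / (1 - (1 - (w x₀)⁻¹) ^ L) := by
  have hW : 1 ≤ w x₀ := one_le_of_mode (q := q) hmax
  have hr0 : 0 ≤ 1 - (w x₀)⁻¹ := sub_nonneg.2 (inv_le_one_of_one_le₀ hW)
  have hr1 : 1 - (w x₀)⁻¹ < 1 := sub_lt_self _ (inv_pos.mpr (hw0 x₀))
  have hrL0 : 0 ≤ (1 - (w x₀)⁻¹) ^ L := pow_nonneg hr0 L
  have hrL1 : (1 - (w x₀)⁻¹) ^ L < 1 := pow_lt_one₀ hr0 hr1 (by omega)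
  have hgeo : HasSum (fun j : ℕ => (1 - (w x₀)⁻¹) ^ k * (c - a) * ((1 - (w x₀)⁻¹) ^ L) ^ j)
      ((1 - (w x₀)⁻¹) ^ k * (c - a) * (1 - (1 - (w x₀)⁻¹) ^ L)⁻¹) :=
    (hasSum_geometric_of_lt_one hrL0 hrL1).mul_left _
  rw [div_eq_mul_inv]
  refine (Summable.tsum_le_tsum (fun j => ?_) (crnLagL_summable_integral_abs_diff hw0 hmax Khat hK μ₀ hf ha hc k hL)
    hgeo.summable).trans_eq hgeo.tsum_eq
  have h := crnLagL_integral_abs_diff_le hw0 hmax Khat hK μ₀ hf ha hc k L j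
  linarith [h]

/-! ## §2 Exact unbiasedness of the lag-`L` estimator -/

/-- **EXACT UNBIASEDNESS, LAG `L`: THE EXPECTED CORRECTIONS SUM TO THE BURN-IN BIAS.**  `w` measurable (a `Fact`), positive, normalised, maximal
at `x₀`; `K̂` a CRN pair kernel; the initial coupling `L ≥ 1` steps ahead in its first coordinate (`μ̂₀∘fst⁻¹ = (μ̂₀∘snd⁻¹)K^L`); `a ≤ f ≤ c`
measurable.  Then for every `k`: `Σ_{j≥0} E[f(X′_{k+jL}) − f(Y_{k+jL})] = π f − E f(Y_k)`. [ours] -/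
theorem crnLagL_hasSum_integral_diff [Fact (Measurable w)] (hw0 : ∀ y, 0 < w y) {x₀ : Ω} (hmax : ∀ y, w y ≤ w x₀)
    [IsProbabilityMeasure (q.withDensity fun y => ENNReal.ofReal (w y))]
    (Khat : Kernel (Ω × Ω) (Ω × Ω)) [IsMarkovKernel Khat]
    (hK : ∀ z : Ω × Ω, Khat z = (q.prod (volume : Measure unitInterval)).map (fun p : Ω × unitInterval =>
      ((if (p.2 : ℝ) * w z.1 ≤ w p.1 then p.1 else z.1), (if (p.2 : ℝ) * w z.2 ≤ w p.1 then p.1 else z.2))))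
    (μ₀ : Measure (Ω × Ω)) [IsProbabilityMeasure μ₀] {L : ℕ} (hL : 1 ≤ L)
    (hlag : μ₀.map Prod.fst = (fun m : Measure Ω => m.bind (indepMH q w))^[L] (μ₀.map Prod.snd)) {f : Ω → ℝ} (hf : Measurable f)
    {a c : ℝ} (ha : ∀ x, a ≤ f x) (hc : ∀ x, f x ≤ c) (k : ℕ) :
    HasSum (fun j : ℕ => ∫ z, (f ((z (k + j * L)).1) - f ((z (k + j * L)).2))
        ∂(Kernel.trajMeasure (X := fun _ : ℕ => Ω × Ω) μ₀
          (fun n : ℕ => Khat.comap (fun h : (i : ↥(Finset.Iic n)) → Ω × Ω => h ⟨n, Finset.mem_Iic.2 le_rfl⟩)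
            (measurable_pi_apply _))))
      (∫ x, f x ∂(q.withDensity fun y => ENNReal.ofReal (w y)) -
        ∫ z, f ((z k).2) ∂(Kernel.trajMeasure (X := fun _ : ℕ => Ω × Ω) μ₀
          (fun n : ℕ => Khat.comap (fun h : (i : ↥(Finset.Iic n)) → Ω × Ω => h ⟨n, Finset.mem_Iic.2 le_rfl⟩)
            (measurable_pi_apply _)))) := by
  haveI : IsProbabilityMeasure (μ₀.map Prod.snd) := Measure.isProbabilityMeasure_map measurable_snd.aemeasurable
  set u : ℕ → ℝ := fun N => ∫ y, f y ∂((fun m : Measure Ω => m.bind (indepMH q w))^[N] (μ₀.map Prod.snd)) with hu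
  have hC : ∀ x, |f x| ≤ max |a| |c| := fun x => abs_le_max_abs_abs (ha x) (hc x)
  have hidx : ∀ j, k + j * L + L = k + (j + 1) * L := fun j => by ring
  have hterm : ∀ j, ∫ z, (f ((z (k + j * L)).1) - f ((z (k + j * L)).2))
      ∂(Kernel.trajMeasure (X := fun _ : ℕ => Ω × Ω) μ₀
        (fun n : ℕ => Khat.comap (fun h : (i : ↥(Finset.Iic n)) → Ω × Ω => h ⟨n, Finset.mem_Iic.2 le_rfl⟩)
          (measurable_pi_apply _))) = u (k + (j + 1) * L) - u (k + j * L) := by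
    intro j
    rw [crnLagL_integral_diff_eq hw0 Khat hK μ₀ hlag hf hC k j, hidx j]
  have hYk : ∫ z, f ((z k).2) ∂(Kernel.trajMeasure (X := fun _ : ℕ => Ω × Ω) μ₀
        (fun n : ℕ => Khat.comap (fun h : (i : ↥(Finset.Iic n)) → Ω × Ω => h ⟨n, Finset.mem_Iic.2 le_rfl⟩)
          (measurable_pi_apply _))) = u k := crnLag_integral_snd_eq hw0 Khat hK μ₀ hf hC k
  simp_rw [hterm]
  rw [hYk]
  -- `u N → π f`
  have hW : 1 ≤ w x₀ := one_le_of_mode (q := q) hmax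
  have hr0 : 0 ≤ 1 - (w x₀)⁻¹ := sub_nonneg.2 (inv_le_one_of_one_le₀ hW)
  have hr1 : 1 - (w x₀)⁻¹ < 1 := sub_lt_self _ (inv_pos.mpr (hw0 x₀))
  have hlim : Tendsto u atTop (𝓝 (∫ x, f x ∂(q.withDensity fun y => ENNReal.ofReal (w y)))) := by
    have hgeom : Tendsto (fun N : ℕ => (1 - (w x₀)⁻¹) ^ N * (c - a)) atTop (𝓝 (0 * (c - a))) :=
      (tendsto_pow_atTop_nhds_zero_of_lt_one hr0 hr1).mul_const _
    rw [zero_mul] at hgeom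
    refine tendsto_iff_norm_sub_tendsto_zero.2 (squeeze_zero (fun N => norm_nonneg _) (fun N => ?_) hgeom)
    rw [Real.norm_eq_abs]
    haveI := isProbabilityMeasure_iterate_bind (κ := indepMH q w) (μ₀.map Prod.snd) N
    exact integral_iterate_bind_indepMH_abs_le (q := q) Fact.out hw0 hmax N (μ₀.map Prod.snd) hf ha hc
  -- telescoping partial sums along the progression `k + jL`
  have hpartial : ∀ J, ∑ j ∈ Finset.range J, (u (k + (j + 1) * L) - u (k + j * L)) = u (k + J * L) - u k := by
    intro J
    induction J with
    | zero => simp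
    | succ J ih => rw [Finset.sum_range_succ, ih]; ring
  have hsumm : Summable (fun j : ℕ => u (k + (j + 1) * L) - u (k + j * L)) := by
    refine Summable.of_norm_bounded (g := fun j : ℕ => ∫ z, |f ((z (k + j * L)).1) - f ((z (k + j * L)).2)|
      ∂(Kernel.trajMeasure (X := fun _ : ℕ => Ω × Ω) μ₀
        (fun n : ℕ => Khat.comap (fun h : (i : ↥(Finset.Iic n)) → Ω × Ω => h ⟨n, Finset.mem_Iic.2 le_rfl⟩)
          (measurable_pi_apply _)))) (crnLagL_summable_integral_abs_diff hw0 hmax Khat hK μ₀ hf ha hc k hL) (fun j => ?_)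
    rw [← hterm j, Real.norm_eq_abs]
    exact abs_integral_le_integral_abs
  have hlim2 : Tendsto (fun J => ∑ j ∈ Finset.range J, (u (k + (j + 1) * L) - u (k + j * L))) atTop
      (𝓝 (∫ x, f x ∂(q.withDensity fun y => ENNReal.ofReal (w y)) - u k)) := by
    simp_rw [hpartial]
    have hshift : Tendsto (fun J => u (k + J * L)) atTop (𝓝 (∫ x, f x ∂(q.withDensity fun y => ENNReal.ofReal (w y)))) :=
      hlim.comp (tendsto_atTop_atTop_of_monotone (fun _ _ h => Nat.add_le_add_left (Nat.mul_le_mul_right L h) k)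
        fun N => ⟨N, (Nat.le_mul_of_pos_right N (by omega)).trans (Nat.le_add_left _ k)⟩)
    exact hshift.sub_const (u k)
  have heq : ∑' j, (u (k + (j + 1) * L) - u (k + j * L)) = ∫ x, f x ∂(q.withDensity fun y => ENNReal.ofReal (w y)) - u k :=
    tendsto_nhds_unique hsumm.hasSum.tendsto_sum_nat hlim2
  rw [← heq]
  exact hsumm.hasSum

/-- **THE EXPECTATION OF THE SUMMED LAG-`L` CORRECTIONS IS THE SUM OF THEIR EXPECTATIONS**:
`E[Σ_{j≥0}(f(X′_{k+jL}) − f(Y_{k+jL}))] = π f − E f(Y_k)`. [ours] -/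
theorem crnLagL_integral_tsum_diff_eq [Fact (Measurable w)] (hw0 : ∀ y, 0 < w y) {x₀ : Ω} (hmax : ∀ y, w y ≤ w x₀)
    [IsProbabilityMeasure (q.withDensity fun y => ENNReal.ofReal (w y))]
    (Khat : Kernel (Ω × Ω) (Ω × Ω)) [IsMarkovKernel Khat]
    (hK : ∀ z : Ω × Ω, Khat z = (q.prod (volume : Measure unitInterval)).map (fun p : Ω × unitInterval =>
      ((if (p.2 : ℝ) * w z.1 ≤ w p.1 then p.1 else z.1), (if (p.2 : ℝ) * w z.2 ≤ w p.1 then p.1 else z.2))))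
    (μ₀ : Measure (Ω × Ω)) [IsProbabilityMeasure μ₀] {L : ℕ} (hL : 1 ≤ L)
    (hlag : μ₀.map Prod.fst = (fun m : Measure Ω => m.bind (indepMH q w))^[L] (μ₀.map Prod.snd)) {f : Ω → ℝ} (hf : Measurable f)
    {a c : ℝ} (ha : ∀ x, a ≤ f x) (hc : ∀ x, f x ≤ c) (k : ℕ) :
    ∫ z, (∑' j : ℕ, (f ((z (k + j * L)).1) - f ((z (k + j * L)).2)))
        ∂(Kernel.trajMeasure (X := fun _ : ℕ => Ω × Ω) μ₀
          (fun n : ℕ => Khat.comap (fun h : (i : ↥(Finset.Iic n)) → Ω × Ω => h ⟨n, Finset.mem_Iic.2 le_rfl⟩)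
            (measurable_pi_apply _))) =
      ∫ x, f x ∂(q.withDensity fun y => ENNReal.ofReal (w y)) -
        ∫ z, f ((z k).2) ∂(Kernel.trajMeasure (X := fun _ : ℕ => Ω × Ω) μ₀
          (fun n : ℕ => Khat.comap (fun h : (i : ↥(Finset.Iic n)) → Ω × Ω => h ⟨n, Finset.mem_Iic.2 le_rfl⟩)
            (measurable_pi_apply _))) := by
  set P := Kernel.trajMeasure (X := fun _ : ℕ => Ω × Ω) μ₀
        (fun n : ℕ => Khat.comap (fun h : (i : ↥(Finset.Iic n)) → Ω × Ω => h ⟨n, Finset.mem_Iic.2 le_rfl⟩)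
          (measurable_pi_apply _)) with hP
  have hDm : ∀ j, Measurable (fun z : ℕ → Ω × Ω => f ((z (k + j * L)).1) - f ((z (k + j * L)).2)) := fun j =>
    (hf.comp (measurable_fst.comp (measurable_pi_apply _))).sub (hf.comp (measurable_snd.comp (measurable_pi_apply _)))
  have hDb : ∀ j (z : ℕ → Ω × Ω), |f ((z (k + j * L)).1) - f ((z (k + j * L)).2)| ≤ c - a := by
    intro j z
    have h1 := ha ((z (k + j * L)).1); have h2 := hc ((z (k + j * L)).1)
    have h3 := ha ((z (k + j * L)).2); have h4 := hc ((z (k + j * L)).2)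
    exact abs_le.2 ⟨by linarith, by linarith⟩
  have hDi : ∀ j, Integrable (fun z : ℕ → Ω × Ω => f ((z (k + j * L)).1) - f ((z (k + j * L)).2)) P := fun j =>
    integrable_of_bounded P (hDm j) (hDb j)
  have hsum : Summable (fun j => ∫ z, ‖f ((z (k + j * L)).1) - f ((z (k + j * L)).2)‖ ∂P) := by
    simp_rw [Real.norm_eq_abs]
    exact crnLagL_summable_integral_abs_diff hw0 hmax Khat hK μ₀ hf ha hc k hL
  rw [← integral_tsum_of_summable_integral_norm hDi hsum]
  exact (crnLagL_hasSum_integral_diff hw0 hmax Khat hK μ₀ hL hlag hf ha hc k).tsum_eq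

/-- **THE LAG-`L` COUPLED ESTIMATOR IS EXACTLY UNBIASED FROM EVERY START**: `E f(Y_k) + E[Σ_{j≥0}(f(X′_{k+jL}) − f(Y_{k+jL}))] = π f`, every
`L ≥ 1`, every `k`. [ours] -/
theorem crnLagL_unbiased [Fact (Measurable w)] (hw0 : ∀ y, 0 < w y) {x₀ : Ω} (hmax : ∀ y, w y ≤ w x₀)
    [IsProbabilityMeasure (q.withDensity fun y => ENNReal.ofReal (w y))]
    (Khat : Kernel (Ω × Ω) (Ω × Ω)) [IsMarkovKernel Khat]
    (hK : ∀ z : Ω × Ω, Khat z = (q.prod (volume : Measure unitInterval)).map (fun p : Ω × unitInterval =>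
      ((if (p.2 : ℝ) * w z.1 ≤ w p.1 then p.1 else z.1), (if (p.2 : ℝ) * w z.2 ≤ w p.1 then p.1 else z.2))))
    (μ₀ : Measure (Ω × Ω)) [IsProbabilityMeasure μ₀] {L : ℕ} (hL : 1 ≤ L)
    (hlag : μ₀.map Prod.fst = (fun m : Measure Ω => m.bind (indepMH q w))^[L] (μ₀.map Prod.snd)) {f : Ω → ℝ} (hf : Measurable f)
    {a c : ℝ} (ha : ∀ x, a ≤ f x) (hc : ∀ x, f x ≤ c) (k : ℕ) :
    ∫ z, f ((z k).2) ∂(Kernel.trajMeasure (X := fun _ : ℕ => Ω × Ω) μ₀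
          (fun n : ℕ => Khat.comap (fun h : (i : ↥(Finset.Iic n)) → Ω × Ω => h ⟨n, Finset.mem_Iic.2 le_rfl⟩)
            (measurable_pi_apply _))) +
      ∫ z, (∑' j : ℕ, (f ((z (k + j * L)).1) - f ((z (k + j * L)).2)))
        ∂(Kernel.trajMeasure (X := fun _ : ℕ => Ω × Ω) μ₀
          (fun n : ℕ => Khat.comap (fun h : (i : ↥(Finset.Iic n)) → Ω × Ω => h ⟨n, Finset.mem_Iic.2 le_rfl⟩)
            (measurable_pi_apply _))) =
      ∫ x, f x ∂(q.withDensity fun y => ENNReal.ofReal (w y)) := by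
  rw [crnLagL_integral_tsum_diff_eq hw0 hmax Khat hK μ₀ hL hlag hf ha hc k]
  ring

end Summit.Ventures.LatticeQCDFlow.Exactness

end
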